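/-
Copyright (c) 2026. All rights reserved.
Released under Apache 2.0 license as described in the file LICENSE.
Authors: abc-iut cell — seat abc-iut-L4-t8 (gen 9; proof-only companion of `HolomorphicCores.lean`,
typed by abc-iut-L4-t2 / abc-iut-L4-t14; [AbsTopIII] Cor 2.4 functoriality clause at print's exact
class of morphisms — reader's point of abc-iut-L4-t7 gen 5).
-/
import Literature.AnabelianGeometry.AbsoluteAnabelian.HolomorphicCoresFunctorialityProofs
import Literature.AnabelianGeometry.AbsoluteAnabelian.HolomorphicCoresLiftedStructureUnique
import Literature.AnabelianGeometry.AbsoluteAnabelian.ArchimedeanHolFieldFunctorGeometricRCOver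
import Literature.AnabelianGeometry.AbsoluteAnabelian.AutHolomorphicSpacesTransportProofs
import Literature.Geometry.Kaehler.RiemannSurfaceUniversalCover
import HarnessLib

/-!
# Proof-only companion of `HolomorphicCores`: the functoriality clause of [AbsTopIII] Cor 2.4 for finite étale MORPHISMS OF AUT-HOLOMORPHIC SPACES

S. Mochizuki, *Topics in absolute anabelian geometry III*, Cor 2.4 (kurims p.55 l.11–12): «the
asserted "functoriality" is with respect to finite étale morphisms of Aut-holomorphic spaces arising
from hyperbolic curves over `ℂ`».  `cor24_functorial` (`HolomorphicCoresFunctorialityProofs`) proves it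
for HOLOMORPHIC finite étale maps `f : X′ → X`.  Print's class is larger: a finite étale morphism of
Aut-holomorphic spaces `𝕏′ → 𝕏` is an RC-holomorphic finite covering (Cor 2.3 (i)), possibly
ANTI-holomorphic for the given complex structures.  This file closes the gap by the remark that the
Aut-holomorphic space does not see the difference: re-structuring `X′^top` by the complex structure
PULLED BACK from `X` along `f` (Lin (7.5.2.1), `IsLocalHomeomorph.comapChartedSpace`) makes `f`
holomorphic and leaves `𝕏′` — and the lifted `𝕌` — UNCHANGED, by the uniqueness of lifted structures
(`ofCharted_eq_of_isLiftedStructure`, Cor 2.3 (ii)).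

* `IsMorphism.isLiftedStructure` — a morphism of Aut-holomorphic spaces `𝕌 → 𝕏` along an étale `p`
  exhibits `𝒜_U` as a lifted structure (restriction of the local-morphism condition to `𝒰_p`);
* `mem_holAut_top_iff_of_restrict` — bookkeeping: `γ ∈ Aut(U^top)` is biholomorphic iff its restriction
  to `⊤ : Opens U` lies in `Aut^hol(⊤)`;
* `exists_chartedSpace_pullback_package` — for étale `f : X′ → X`, `p : U → X′`: complex structures
  `c′` on `X′^top` and `c_U′` on `U^top` pulled back from `X` with `f`, `f ∘ p`, `p` holomorphic, the
  resulting Aut-holomorphic structures lifted along `f`, `p`, `f ∘ p`, and every deck transformation of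
  `f ∘ p` in `Aut^hol_{c_U′}(U^top)`;
* `cor24_functorial_of_isMorphism` — **the functoriality clause at print's binders verbatim**: for a
  finite étale MORPHISM OF AUT-HOLOMORPHIC SPACES `f : 𝕏′ → 𝕏` (`IsFiniteEtale f`,
  `IsMorphism (ofCharted X′) (ofCharted X) f`), `X` connected, and a universal covering
  `p : U → X′` whose Aut-holomorphic disc `𝕌` is LIFTED from `𝕏′` (print's (b)): `f ∘ p` is a universal
  covering of `X` along which `𝕌` is again the lifted structure; (a) `Aut(U/X′) ≤ Aut(U/X)` of finite
  index; (b) both inside `Aut⁰(𝕌)`; (c) equal commensurators `Π` in `G = Aut⁰(𝕌)`, equivalent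
  (non-)arithmeticity, equal core data.

Everything is a theorem (no `def … : Prop`).  Refereed pre-IUT material; nothing here bears on the
disputed [IUTchIII] Cor. 3.12; no side is taken.
-/

noncomputable section

namespace Literature.AnabelianGeometry.AbsoluteAnabelian

open _root_.TopologicalSpace _root_.Topology _root_.Set _root_.Function
open scoped _root_.Manifold _root_.ContDiff
open Literature.Topology.CoveringSpaces Literature.Geometry.Kaehler
open Literature.Geometry.Kaehler.ComplexTorus (mem_deckTransformations_iff)

universe u

/-! ### A morphism of Aut-holomorphic spaces along `p` is a lifted structure -/

section Morphism

variable {X : Type u} [TopologicalSpace X] {U : Type u} [TopologicalSpace U]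

/-- A `(𝒰, 𝒱)`-local morphism is a `(𝒰′, 𝒱′)`-local morphism for any SMALLER collections
`𝒰′ ⊆ 𝒰`, `𝒱′ ⊆ 𝒱` (fewer conditions). [cite: MochizukiAbsTopIII2015, Definition 2.1 (ii) pp.50–51] -/
theorem IsLocalMorphism.mono {A : AutHolStructure U} {B : AutHolStructure X} {𝒰 𝒰' : Set (Opens U)}
    {𝒱 𝒱' : Set (Opens X)} {φ : U → X} (h : IsLocalMorphism A B 𝒰 𝒱 φ) (h𝒰 : 𝒰' ⊆ 𝒰)
    (h𝒱 : 𝒱' ⊆ 𝒱) : IsLocalMorphism A B 𝒰' 𝒱' φ :=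
  ⟨h.isLocalHomeomorph, fun U' V hU' hV e he => h.map_aut_eq U' V (h𝒰 hU') (h𝒱 hV) e he⟩

/-- **A morphism of Aut-holomorphic spaces `𝕌 → 𝕏` along an étale `p` exhibits `𝒜_U` as a structure
LIFTED along `p`** (`IsLiftedStructure`): the local-morphism condition on all connected opens restricts
to the connected opens on which `p` is injective. [cite: MochizukiAbsTopIII2015, Corollary 2.4 (b) p.54] -/
theorem IsMorphism.isLiftedStructure {A : AutHolStructure X} {AU : AutHolStructure U} {p : U → X}
    (h : IsMorphism AU A p) : IsLiftedStructure A p AU :=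
  IsLocalMorphism.mono h (fun _ hV => hV.1) (fun _ hW => hW)

end Morphism

/-! ### Bookkeeping: biholomorphic self-homeomorphisms and `Aut^hol(⊤)` -/

section Top

variable {U : Type u} [TopologicalSpace U] [ChartedSpace ℂ U]

/-- A self-homeomorphism `γ` of a space charted over `ℂ` is biholomorphic iff its restriction `ψ` to
the open subset `⊤` lies in `Aut^hol(⊤)` (`holAut`). [cite: MochizukiAbsTopIII2015, Definition 2.1 (i) p.50] -/
theorem mem_holAut_top_iff_of_restrict (γ : U ≃ₜ U) (ψ : (⊤ : Opens U) ≃ₜ (⊤ : Opens U))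
    (hψ : ∀ x, (ψ x : U) = γ x) (hψs : ∀ y, (ψ.symm y : U) = γ.symm y) :
    ψ ∈ holAut (⊤ : Opens U) ↔
      MDifferentiable 𝓘(ℂ, ℂ) 𝓘(ℂ, ℂ) γ ∧ MDifferentiable 𝓘(ℂ, ℂ) 𝓘(ℂ, ℂ) γ.symm := by
  rw [mem_holAut_iff]
  have h1 : MDifferentiable 𝓘(ℂ, ℂ) 𝓘(ℂ, ℂ) (⇑ψ) ↔ MDifferentiable 𝓘(ℂ, ℂ) 𝓘(ℂ, ℂ) (⇑γ) := by
    constructor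
    · intro h x
      exact (mdifferentiableAt_opens_iff (U := (⊤ : Opens U)) (V := (⊤ : Opens U)) (Φ := ⇑γ)
        (Ψ := ⇑ψ) hψ ⟨x, trivial⟩).1 (h ⟨x, trivial⟩)
    · intro h x
      exact (mdifferentiableAt_opens_iff (U := (⊤ : Opens U)) (V := (⊤ : Opens U)) (Φ := ⇑γ)
        (Ψ := ⇑ψ) hψ x).2 (h x)
  have h2 : MDifferentiable 𝓘(ℂ, ℂ) 𝓘(ℂ, ℂ) (⇑ψ.symm) ↔
      MDifferentiable 𝓘(ℂ, ℂ) 𝓘(ℂ, ℂ) (⇑γ.symm) := by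
    constructor
    · intro h x
      exact (mdifferentiableAt_opens_iff (U := (⊤ : Opens U)) (V := (⊤ : Opens U)) (Φ := ⇑γ.symm)
        (Ψ := ⇑ψ.symm) hψs ⟨x, trivial⟩).1 (h ⟨x, trivial⟩)
    · intro h x
      exact (mdifferentiableAt_opens_iff (U := (⊤ : Opens U)) (V := (⊤ : Opens U)) (Φ := ⇑γ.symm)
        (Ψ := ⇑ψ.symm) hψs x).2 (h x)
  rw [h1, h2]

/-- If two complex structures on `U^top` have the same Aut-holomorphic structure, a self-homeomorphism
restricted to `⊤` lies in `Aut^hol` for one iff for the other (`U^top` connected, so that `⊤` is a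
connected open at which the two structures are compared). [cite: MochizukiAbsTopIII2015, Definition 2.1 (i) p.50] -/
theorem mem_holAut_top_iff_of_ofCharted_eq {V : Type u} [TopologicalSpace V] [ConnectedSpace V]
    (c₁ c₂ : ChartedSpace ℂ V)
    (h : @AutHolStructure.ofCharted V _ c₁ = @AutHolStructure.ofCharted V _ c₂)
    (ψ : (⊤ : Opens V) ≃ₜ (⊤ : Opens V)) :
    ψ ∈ @holAut V _ c₁ ⊤ ↔ ψ ∈ @holAut V _ c₂ ⊤ := by
  have htop : IsConnected ((⊤ : Opens V) : Set V) := by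
    rw [Opens.coe_top]; exact isConnected_univ
  have := congrArg (fun A : AutHolStructure V => A.aut ⟨⊤, htop⟩) h
  simp only [AutHolStructure.ofCharted_aut] at this
  rw [this]

end Top

/-! ### The pulled-back structures: `f`, `f ∘ p`, `p` holomorphic, `𝕏′` and `𝕌` unchanged -/

section Pullback

variable {X : Type u} [TopologicalSpace X] [ChartedSpace ℂ X] [IsManifold 𝓘(ℂ, ℂ) ω X]
  {X' : Type u} [TopologicalSpace X'] {U : Type u} [TopologicalSpace U]

/-- **The pulled-back package.**  For étale maps `f : X′^top → X`, `p : U^top → X′^top` into a Riemann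
surface `X`: the complex structures `c′` on `X′^top` and `c_U′` on `U^top` pulled back from `X` along
`f` and `f ∘ p` (Lin (7.5.2.1)) are Riemann-surface structures for which `f`, `f ∘ p` and `p` are
holomorphic; consequently `𝒜_{(X′,c′)}` is lifted from `𝒜_X` along `f`, `𝒜_{(U,c_U′)}` is lifted from
`𝒜_{(X′,c′)}` along `p` and from `𝒜_X` along `f ∘ p`, and every deck transformation of `f ∘ p`
restricts to an element of `Aut^hol_{c_U′}(⊤)`.
[cite: Lin2011ClassicalComplexAnalysisII, §7.5.2 (7.5.2.1)] [cite: MochizukiAbsTopIII2015, Corollary 2.4 (b) p.54] -/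
theorem exists_chartedSpace_pullback_package {f : X' → X} {p : U → X'} (hf : IsLocalHomeomorph f)
    (hp : IsLocalHomeomorph p) :
    ∃ (c' : ChartedSpace ℂ X') (cU' : ChartedSpace ℂ U)
      (_ : @IsManifold ℂ _ ℂ _ _ ℂ _ 𝓘(ℂ, ℂ) ω X' _ c') (_ : @IsManifold ℂ _ ℂ _ _ ℂ _ 𝓘(ℂ, ℂ) ω U _ cU'),
      IsLiftedStructure (AutHolStructure.ofCharted X) f (@AutHolStructure.ofCharted X' _ c') ∧
      IsLiftedStructure (@AutHolStructure.ofCharted X' _ c') p (@AutHolStructure.ofCharted U _ cU') ∧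
      IsLiftedStructure (AutHolStructure.ofCharted X) (f ∘ p) (@AutHolStructure.ofCharted U _ cU') ∧
      ∀ γ : U ≃ₜ U, γ ∈ deckGroup (f ∘ p) → ∀ ψ : (⊤ : Opens U) ≃ₜ (⊤ : Opens U),
        (∀ x, (ψ x : U) = γ x) → (∀ y, (ψ.symm y : U) = γ.symm y) → ψ ∈ @holAut U _ cU' ⊤ := by
  have hq : IsLocalHomeomorph (f ∘ p) := hf.comp hp
  letI c' : ChartedSpace ℂ X' := IsLocalHomeomorph.comapChartedSpace ℂ hf
  haveI m' : IsManifold 𝓘(ℂ, ℂ) ω X' := IsLocalHomeomorph.isManifold_comap hf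
  have hfd : MDifferentiable 𝓘(ℂ, ℂ) 𝓘(ℂ, ℂ) f :=
    IsLocalHomeomorph.mdifferentiable_proj (I := 𝓘(ℂ, ℂ)) (n := ω) hf (by simp)
  have hfl : IsLocalDiffeomorph 𝓘(ℂ, ℂ) 𝓘(ℂ, ℂ) ω f := IsLocalHomeomorph.isLocalDiffeomorph_proj hf
  letI cU' : ChartedSpace ℂ U := IsLocalHomeomorph.comapChartedSpace ℂ hq
  haveI mU' : IsManifold 𝓘(ℂ, ℂ) ω U := IsLocalHomeomorph.isManifold_comap hq
  have hqd : MDifferentiable 𝓘(ℂ, ℂ) 𝓘(ℂ, ℂ) (f ∘ p) :=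
    IsLocalHomeomorph.mdifferentiable_proj (I := 𝓘(ℂ, ℂ)) (n := ω) hq (by simp)
  have hql : IsLocalDiffeomorph 𝓘(ℂ, ℂ) 𝓘(ℂ, ℂ) ω (f ∘ p) :=
    IsLocalHomeomorph.isLocalDiffeomorph_proj hq
  -- `p` is holomorphic for `(c_U′, c′)`: `f ∘ p` holomorphic, `f` a holomorphic local biholomorphism
  have hpd : MDifferentiable 𝓘(ℂ, ℂ) 𝓘(ℂ, ℂ) p := fun u =>
    (isHolAt_of_isLocalDiffeomorph_comp (g := p) (π := f) hfl hp.continuous.continuousAt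
      (Filter.Eventually.of_forall fun y => hqd y)).self_of_nhds
  refine ⟨c', cU', m', mU', isLiftedStructure_ofCharted_of_isLocalHomeomorph hf hfd,
    isLiftedStructure_ofCharted_of_isLocalHomeomorph hp hpd,
    isLiftedStructure_ofCharted_of_isLocalHomeomorph hq hqd, fun γ hγ ψ hψ hψs => ?_⟩
  have hγq : ∀ y, (f ∘ p) (γ y) = (f ∘ p) y := (mem_deckTransformations_iff (f ∘ p) γ).1 hγ
  obtain ⟨h1, h2⟩ := mdifferentiable_homeomorph_of_comp_eq_of_isLocalDiffeomorph hql hqd γ hγq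
  exact (mem_holAut_top_iff_of_restrict γ ψ hψ hψs).2 ⟨h1, h2⟩

end Pullback

/-! ### The functoriality clause for finite étale morphisms of Aut-holomorphic spaces -/

section Functorial

/-- **[AbsTopIII] Cor 2.4, the functoriality clause, for finite étale MORPHISMS OF AUT-HOLOMORPHIC
SPACES** (print p.55 l.11–12, verbatim class).  Let `f : X′ → X` be finite étale and a morphism of the
Aut-holomorphic spaces `𝕏′ → 𝕏` of two Riemann surfaces (`X` connected; print's «of finite type»
plays no role and is not assumed) — by Cor 2.3 (i)
an RC-holomorphic finite covering, holomorphic OR anti-holomorphic for the given complex structures —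
and let `p : U^top → X′^top` be a surjective universal covering whose Aut-holomorphic disc `𝕌` is the
structure LIFTED from `𝕏′` (Cor 2.4 (b)).  Then `f ∘ p` is a surjective universal covering of `X` and
`𝕌` is ALSO the structure lifted from `𝕏` along `f ∘ p`; (a) `Aut(U/X′) ≤ Aut(U/X)` in `Aut(U^top)`,
of finite index; (b) both deck groups lie in `Aut⁰(𝕌)`; (c) for `G = Aut⁰(𝕌)` the commensurators `Π`
coincide, `X′` is non-arithmetic iff `X` is, and the hyperbolic-core data `[𝕌/Π]` are equal.  Proof:
the complex structures on `X′^top`, `U^top` pulled back from `X` make `f`, `p`, `f ∘ p` holomorphic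
without changing `𝕏′` or `𝕌` (`ofCharted_eq_of_isLiftedStructure`), and the holomorphic case is
`cor24_functorial`'s argument. [cite: MochizukiAbsTopIII2015, Corollary 2.4 p.55] -/
theorem cor24_functorial_of_isMorphism {X : Type} [TopologicalSpace X] [T2Space X] [ConnectedSpace X]
    [ChartedSpace ℂ X] [IsManifold 𝓘(ℂ, ℂ) ω X]
    {X' : Type} [TopologicalSpace X'] [T2Space X'] [cX' : ChartedSpace ℂ X']
    [mX' : IsManifold 𝓘(ℂ, ℂ) ω X']
    {U : Type} [TopologicalSpace U] [T2Space U] [SimplyConnectedSpace U] [cU : ChartedSpace ℂ U]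
    [mU : IsManifold 𝓘(ℂ, ℂ) ω U]
    {f : X' → X} (hf : IsFiniteEtale f)
    (hfm : IsMorphism (AutHolStructure.ofCharted X') (AutHolStructure.ofCharted X) f)
    {p : U → X'} (hp : IsCoveringMap p) (hps : Function.Surjective p)
    (hpl : IsLiftedStructure (AutHolStructure.ofCharted X') p (AutHolStructure.ofCharted U))
    (hU : IsAutHolDisc U) :
    (IsCoveringMap (f ∘ p) ∧ Function.Surjective (f ∘ p) ∧
      IsLiftedStructure (AutHolStructure.ofCharted X) (f ∘ p) (AutHolStructure.ofCharted U)) ∧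
    (deckGroup p ≤ deckGroup (f ∘ p) ∧ (deckGroup p).relIndex (deckGroup (f ∘ p)) ≠ 0) ∧
    (((deckGroup p : Subgroup (U ≃ₜ U)) : Set (U ≃ₜ U)) ⊆ autIdComponent (AutHolStructure.ofCharted U) ∧
      ((deckGroup (f ∘ p) : Subgroup (U ≃ₜ U)) : Set (U ≃ₜ U)) ⊆
        autIdComponent (AutHolStructure.ofCharted U)) ∧
    ∀ G : Subgroup (U ≃ₜ U), (G : Set (U ≃ₜ U)) = autIdComponent (AutHolStructure.ofCharted U) →
      Subgroup.Commensurable.commensurator ((deckGroup p).subgroupOf G) =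
          Subgroup.Commensurable.commensurator ((deckGroup (f ∘ p)).subgroupOf G) ∧
        (IsMargulisNonArithmetic G (deckGroup p) ↔ IsMargulisNonArithmetic G (deckGroup (f ∘ p))) ∧
        (Subgroup.Commensurable.commensurator ((deckGroup p).subgroupOf G)).map G.subtype =
          (Subgroup.Commensurable.commensurator ((deckGroup (f ∘ p)).subgroupOf G)).map G.subtype := by
  haveI := ChartedSpace.locallyPathConnectedSpace ℂ U
  -- the composite universal covering (topology)
  have hq : IsCoveringMap (f ∘ p) := isCoveringMap_comp_of_simplyConnected hf.isCoveringMap hp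
  haveI : Nonempty X' := Nonempty.map p inferInstance
  have hfs : Function.Surjective f := hf.isCoveringMap.surjective_of_connectedSpace'
  have hqs : Function.Surjective (f ∘ p) := hfs.comp hps
  have hfm' : IsLiftedStructure (AutHolStructure.ofCharted X) f (AutHolStructure.ofCharted X') :=
    hfm.isLiftedStructure
  -- (a) (topological)
  have hle : deckGroup p ≤ deckGroup (f ∘ p) := deckGroup_le_deckGroup_comp f p
  have hidx : (deckGroup p).relIndex (deckGroup (f ∘ p)) ≠ 0 :=
    relIndex_deckGroup_comp_ne_zero hp hq hf.finite_fibre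
  -- the pulled-back structures (from here on every structure is named explicitly)
  obtain ⟨c', cU', m', mU', hfl', hpl', hql', hdeck⟩ :=
    exists_chartedSpace_pullback_package (X := X) hf.isCoveringMap.isLocalHomeomorph
      hp.isLocalHomeomorph
  -- `𝕏′` unchanged
  have hX' : @AutHolStructure.ofCharted X' _ c' = @AutHolStructure.ofCharted X' _ cX' :=
    @ofCharted_eq_of_isLiftedStructure X _ _ X' _ _ c' cX' m' mX' f hfl' hfm'
  rw [hX'] at hpl'
  -- `𝕌` unchanged
  have hUeq : @AutHolStructure.ofCharted U _ cU' = @AutHolStructure.ofCharted U _ cU :=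
    @ofCharted_eq_of_isLiftedStructure X' _ cX' U _ _ cU' cU mU' mU p hpl' hpl
  rw [hUeq] at hql'
  -- (b): deck transformations of `f ∘ p` are biholomorphic for the given structure on `U`
  have hK : ((deckGroup (f ∘ p) : Subgroup (U ≃ₜ U)) : Set (U ≃ₜ U)) ⊆
      autIdComponent (@AutHolStructure.ofCharted U _ cU) := by
    intro γ hγ
    obtain ⟨ψ, hψ, hψs⟩ := exists_homeomorph_top γ
    have hmem : ψ ∈ @holAut U _ cU' ⊤ := hdeck γ hγ ψ hψ hψs
    rw [mem_holAut_top_iff_of_ofCharted_eq cU' cU hUeq ψ] at hmem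
    obtain ⟨h1, h2⟩ := (@mem_holAut_top_iff_of_restrict U _ cU γ ψ hψ hψs).1 hmem
    exact @mem_autIdComponent_of_mdifferentiable U _ cU hU γ h1 h2
  have hH : ((deckGroup p : Subgroup (U ≃ₜ U)) : Set (U ≃ₜ U)) ⊆
      autIdComponent (@AutHolStructure.ofCharted U _ cU) := fun γ hγ => hK (hle hγ)
  refine ⟨⟨hq, hqs, hql'⟩, ⟨hle, hidx⟩, ⟨hH, hK⟩, fun G hG => ?_⟩
  -- (c)
  have hKG : deckGroup (f ∘ p) ≤ G := by
    intro γ hγ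
    have : γ ∈ (G : Set (U ≃ₜ U)) := by rw [hG]; exact hK hγ
    exact this
  have hC := commensurator_subgroupOf_eq_of_relIndex_ne_zero hle hKG hidx
  exact ⟨hC, isMargulisNonArithmetic_iff_of_relIndex_ne_zero hle hKG hidx, by rw [hC]⟩

end Functorial

end Literature.AnabelianGeometry.AbsoluteAnabelian

end
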